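import Literature.Computability.AlgebraicComplexity.HamiltonianCycleVNP
import Literature.Computability.AlgebraicComplexity.ArithCircuitProofs
import Literature.Computability.AlgebraicComplexity.BruhatDeterminants

/-!
# Route `PartialSorting`, item `BruhatDetInVNP` (stmt-ValiantsHypothesis-13593) — helper layer:
# Lagrange threshold gadgets for the rank test

Support file for the proof that every Bruhat-truncated determinant family
`D_{w_n} = ∑_{σ : σ[i,j] ≤ w_n[i,j] ∀ i j} sgn σ · ∏ₐ X_{a, σ a}` is in `VNP` over `ℂ`
(Valiant's criterion; Bürgisser 2000, Prop. 2.20 / BCS 1997, Prop. (21.15) technique).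

The `VNP` witness (file `PartialSortingBruhatDetInVNP.lean`) evaluates, at the position matrix
`Z = P_σ` of a permutation, the rank counts `σ[i,j] = #{a ≤ i : j ≤ σ a}` (Björner–Brenti 2005,
(2.3)) as the linear forms `∑_{a ≤ i} ∑_{b ≥ j} Z_{a b}` (`algHom_rankCount`), and tests
`σ[i,j] ≤ W` with the polynomial `∑_{v ≤ W} ℓ_v(r)`, where
`ℓ_v(r) = (∏_{u ≤ n, u ≠ v} (v - u))⁻¹ · ∏_{u ≤ n, u ≠ v} (r - u)` is the Lagrange basis
polynomial on the nodes `0, …, n` (characteristic `0`): `ℓ_v(m) = [m = v]` for `m ≤ n`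
(`lagrange_indicator`), hence the threshold gadget takes the value `[m ≤ W]` at `r = m ≤ n`
(`algHom_thresh`). This file proves these evaluations and the size bounds (degree, `complexity`
in the cost calculus of `ArithCircuitProofs.lean`) of the gadgets. No definitions are
introduced: the gadgets are written out, as in the witness.

References: P. Bürgisser, *Completeness and Reduction in Algebraic Complexity Theory* (2000),
Prop. 2.20; A. Björner, F. Brenti, *Combinatorics of Coxeter Groups* (2005), Thm. 2.1.5, (2.3).
-/

noncomputable section

-- single-conjunct layout: Sub = Summit, duplicated namespace component intended
set_option linter.dupNamespace false

namespace Summit.ValiantsHypothesis.ValiantsHypothesis.Theorems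

namespace BruhatDetVNP

open Literature.Computability.AlgebraicComplexity MvPolynomial Finset

universe u v w

variable {k : Type u} [Field k]

/-! ### Scalar Lagrange indicators on the nodes `0, …, n` -/

/-- The node product `∏_{u ≤ n, u ≠ v} (v - u)` of the Lagrange basis polynomial at `v` does not
vanish (characteristic `0`). [folklore] -/
theorem prod_nodes_self_ne_zero [CharZero k] (n v : ℕ) :
    (∏ u ∈ (range (n + 1)).erase v, ((v : k) - u)) ≠ 0 := by
  refine prod_ne_zero_iff.2 fun u hu => sub_ne_zero.2 ?_
  exact_mod_cast (ne_of_mem_erase hu).symm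

/-- The node product `∏_{u ≤ n, u ≠ v} (m - u)` vanishes at every node `m ≤ n` other than `v`.
[folklore] -/
theorem prod_nodes_eq_zero {n v m : ℕ} (hm : m ≤ n) (hmv : m ≠ v) :
    (∏ u ∈ (range (n + 1)).erase v, ((m : k) - u)) = 0 :=
  prod_eq_zero (mem_erase.2 ⟨hmv, mem_range.2 (Nat.lt_succ_of_le hm)⟩) (sub_self _)

/-- **Lagrange indicator**: `(∏_{u ≠ v} (v - u))⁻¹ ∏_{u ≠ v} (m - u) = [m = v]` for `m ≤ n`
(Lagrange interpolation on the nodes `0, …, n`). [folklore] -/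
theorem lagrange_indicator [CharZero k] {n v m : ℕ} (hm : m ≤ n) :
    (∏ u ∈ (range (n + 1)).erase v, ((v : k) - u))⁻¹ *
        ∏ u ∈ (range (n + 1)).erase v, ((m : k) - u) = if m = v then 1 else 0 := by
  split_ifs with h
  · subst h
    exact inv_mul_cancel₀ (prod_nodes_self_ne_zero n m)
  · rw [prod_nodes_eq_zero hm h, mul_zero]

/-! ### The polynomial gadgets -/

section Poly

variable {τ : Type v} {τ' : Type w}

/-- Evaluation of the Lagrange gadget `ℓ_v(r) = C (∏ (v-u))⁻¹ · ∏ (r + C (-u))` under an algebra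
map sending `r` to the constant `m`. [folklore] -/
theorem algHom_lagrange (f : MvPolynomial τ k →ₐ[k] MvPolynomial τ' k) (n v : ℕ)
    (r : MvPolynomial τ k) (m : ℕ) (hr : f r = C (m : k)) :
    f (C (∏ u ∈ (range (n + 1)).erase v, ((v : k) - u))⁻¹ *
        ∏ u ∈ (range (n + 1)).erase v, (r + C (-(u : k)))) =
      C ((∏ u ∈ (range (n + 1)).erase v, ((v : k) - u))⁻¹ *
        ∏ u ∈ (range (n + 1)).erase v, ((m : k) - u)) := by
  rw [map_mul, algHom_C, algebraMap_eq, map_prod, C_mul]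
  congr 1
  rw [map_prod C]
  refine prod_congr rfl fun u _ => ?_
  rw [map_add, algHom_C, algebraMap_eq, hr, ← C_add, sub_eq_add_neg]

/-- **The threshold gadget tests `m ≤ W`**: under an algebra map sending `r` to the constant
`m ≤ n`, `∑_{v ≤ W} ℓ_v(r) ↦ [m ≤ W]`. [folklore] -/
theorem algHom_thresh [CharZero k] (f : MvPolynomial τ k →ₐ[k] MvPolynomial τ' k) {n : ℕ}
    (W : ℕ) (r : MvPolynomial τ k) {m : ℕ} (hr : f r = C (m : k)) (hm : m ≤ n) :
    f (∑ v ∈ range (W + 1), C (∏ u ∈ (range (n + 1)).erase v, ((v : k) - u))⁻¹ *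
        ∏ u ∈ (range (n + 1)).erase v, (r + C (-(u : k)))) = if m ≤ W then 1 else 0 := by
  rw [map_sum]
  simp_rw [algHom_lagrange f n _ r m hr, lagrange_indicator hm, apply_ite C, C_1, C_0]
  rw [sum_ite_eq]
  simp

/-! ### Size of the gadgets -/

/-- `deg ℓ_v(r) ≤ n + 1` when `deg r ≤ 1`. [folklore] -/
theorem totalDegree_lagrange_le (n v : ℕ) (r : MvPolynomial τ k) (hr : r.totalDegree ≤ 1) :
    (C (∏ u ∈ (range (n + 1)).erase v, ((v : k) - u))⁻¹ *
        ∏ u ∈ (range (n + 1)).erase v, (r + C (-(u : k)))).totalDegree ≤ n + 1 := by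
  refine (totalDegree_mul _ _).trans ?_
  rw [totalDegree_C, zero_add]
  refine (totalDegree_prod_le_of_le _ _ 1 fun u _ => (totalDegree_add _ _).trans
    (max_le hr (by rw [totalDegree_C]; exact Nat.zero_le _))).trans ?_
  rw [mul_one]
  exact (card_erase_le).trans (card_range _).le

/-- `deg ∑_{v ≤ W} ℓ_v(r) ≤ n + 1` when `deg r ≤ 1`. [folklore] -/
theorem totalDegree_thresh_le (n W : ℕ) (r : MvPolynomial τ k) (hr : r.totalDegree ≤ 1) :
    (∑ v ∈ range (W + 1), C (∏ u ∈ (range (n + 1)).erase v, ((v : k) - u))⁻¹ *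
        ∏ u ∈ (range (n + 1)).erase v, (r + C (-(u : k)))).totalDegree ≤ n + 1 :=
  totalDegree_sum_le_of_le _ _ _ fun v _ => totalDegree_lagrange_le n v r hr

/-- `L(ℓ_v(r)) ≤ (n+1)(c+1) + (n+1) + 1` when `L(r) ≤ c` (no sharing of `r` is assumed).
[folklore] -/
theorem complexity_lagrange_le (n v : ℕ) (r : MvPolynomial τ k) (c : ℕ)
    (hr : complexity r ≤ c) :
    complexity (C (∏ u ∈ (range (n + 1)).erase v, ((v : k) - u))⁻¹ *
        ∏ u ∈ (range (n + 1)).erase v, (r + C (-(u : k)))) ≤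
      (n + 1) * (c + 1) + (n + 1) + 1 := by
  have hf : ∀ u ∈ (range (n + 1)).erase v,
      complexity (r + C (-(u : k)) : MvPolynomial τ k) ≤ c + 1 := fun u _ =>
    (complexity_add_le_holds _ _).trans (by rw [complexity_C_holds]; omega)
  have hp := complexity_prod_le_of_le _ _ _ hf
  have hcard : ((range (n + 1)).erase v).card ≤ n + 1 := (card_erase_le).trans (card_range _).le
  have hm := complexity_mul_le_holds
    (C (∏ u ∈ (range (n + 1)).erase v, ((v : k) - u))⁻¹ : MvPolynomial τ k)
    (∏ u ∈ (range (n + 1)).erase v, (r + C (-(u : k))))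
  rw [complexity_C_holds] at hm
  have : ((range (n + 1)).erase v).card * (c + 1) ≤ (n + 1) * (c + 1) :=
    Nat.mul_le_mul_right _ hcard
  omega

/-- `L(∑_{v ≤ W} ℓ_v(r)) ≤ (n+1)·((n+1)(c+1) + (n+1) + 1) + (n+1)` when `L(r) ≤ c` and
`W ≤ n`. [folklore] -/
theorem complexity_thresh_le (n W : ℕ) (hW : W ≤ n) (r : MvPolynomial τ k) (c : ℕ)
    (hr : complexity r ≤ c) :
    complexity (∑ v ∈ range (W + 1), C (∏ u ∈ (range (n + 1)).erase v, ((v : k) - u))⁻¹ *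
        ∏ u ∈ (range (n + 1)).erase v, (r + C (-(u : k)))) ≤
      (n + 1) * ((n + 1) * (c + 1) + (n + 1) + 1) + (n + 1) := by
  have hs := complexity_sum_le_of_le (range (W + 1))
    (fun v => C (∏ u ∈ (range (n + 1)).erase v, ((v : k) - u))⁻¹ *
        ∏ u ∈ (range (n + 1)).erase v, (r + C (-(u : k)))) _
    fun v _ => complexity_lagrange_le n v r c hr
  rw [card_range] at hs
  have h1 : (W + 1) * ((n + 1) * (c + 1) + (n + 1) + 1) ≤
      (n + 1) * ((n + 1) * (c + 1) + (n + 1) + 1) := Nat.mul_le_mul_right _ (by omega)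
  omega

end Poly

/-! ### Rank counts of a position matrix -/

section Rank

variable {n : ℕ} {τ : Type v}

/-- A filtered subset of `Fin n` has at most `n` elements. [folklore] -/
theorem card_filter_univ_fin_le (p : Fin n → Prop) [DecidablePred p] :
    (univ.filter p).card ≤ n :=
  (card_filter_le _ _).trans (by simp)

/-- **The rank count at a permutation matrix** (Björner–Brenti 2005, (2.3)): under an algebra map
sending `Z_{a b}` to `[σ a = b]`, `∑_{a ≤ i} ∑_{b ≥ j} Z_{a b} ↦ σ[i,j] = #{a ≤ i : j ≤ σ a}`.
[folklore] -/
theorem algHom_rankCount {τ' : Type w} (f : MvPolynomial τ k →ₐ[k] MvPolynomial τ' k)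
    (Z : Fin n × Fin n → MvPolynomial τ k) (σ : Equiv.Perm (Fin n))
    (hZ : ∀ p, f (Z p) = if σ p.1 = p.2 then 1 else 0) (i j : Fin n) :
    f (∑ a ∈ univ.filter (fun a : Fin n => a ≤ i),
        ∑ b ∈ univ.filter (fun b : Fin n => j ≤ b), Z (a, b)) =
      C (((univ.filter (fun a : Fin n => a ≤ i ∧ j ≤ σ a)).card : ℕ) : k) := by
  simp only [map_sum, hZ]
  have h1 : ∀ a : Fin n, (∑ b ∈ univ.filter (fun b : Fin n => j ≤ b),
      (if σ a = b then (1 : MvPolynomial τ' k) else 0)) = if j ≤ σ a then 1 else 0 := by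
    intro a
    rw [sum_ite_eq]
    simp
  simp_rw [h1]
  rw [sum_boole, filter_filter, map_natCast]

/-- `deg ∑_{a ≤ i} ∑_{b ≥ j} Z_{a b} ≤ 1` for an array of variables. [folklore] -/
theorem totalDegree_rankCount_le (i j : Fin n) (v : Fin n × Fin n → τ) :
    (∑ a ∈ univ.filter (fun a : Fin n => a ≤ i), ∑ b ∈ univ.filter (fun b : Fin n => j ≤ b),
      (X (v (a, b)) : MvPolynomial τ k)).totalDegree ≤ 1 :=
  totalDegree_sum_le_of_le _ _ _ fun _ _ => totalDegree_sum_le_of_le _ _ _ fun _ _ =>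
    totalDegree_X_le_one _

/-- `L(∑_{a ≤ i} ∑_{b ≥ j} Z_{a b}) ≤ n·n + n` for an array of variables (inputs are free).
[folklore] -/
theorem complexity_rankCount_le (i j : Fin n) (v : Fin n × Fin n → τ) :
    complexity (∑ a ∈ univ.filter (fun a : Fin n => a ≤ i),
      ∑ b ∈ univ.filter (fun b : Fin n => j ≤ b), (X (v (a, b)) : MvPolynomial τ k)) ≤
      n * n + n := by
  have hin : ∀ a ∈ univ.filter (fun a : Fin n => a ≤ i),
      complexity (∑ b ∈ univ.filter (fun b : Fin n => j ≤ b), (X (v (a, b)) : MvPolynomial τ k))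
        ≤ n := by
    intro a _
    have h := complexity_sum_le_of_le (univ.filter (fun b : Fin n => j ≤ b))
      (fun b => (X (v (a, b)) : MvPolynomial τ k)) 0 fun _ _ => (complexity_X_holds (k := k) _).le
    have hc := card_filter_univ_fin_le (fun b : Fin n => j ≤ b)
    rw [mul_zero, zero_add] at h
    exact h.trans hc
  have h := complexity_sum_le_of_le (univ.filter (fun a : Fin n => a ≤ i)) _ _ hin
  have hc := card_filter_univ_fin_le (fun a : Fin n => a ≤ i)
  exact h.trans (Nat.add_le_add (Nat.mul_le_mul_right _ hc) hc)

end Rank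

/-! ### Arithmetic and the degree of `D_w` -/

section Arith

variable (n : ℕ)

/-- `n ^ a * (n + 1) ^ b ≤ (n + 1) ^ c` for `a + b ≤ c`. [folklore] -/
theorem pow_mul_pow_le {a b c : ℕ} (h : a + b ≤ c) : n ^ a * (n + 1) ^ b ≤ (n + 1) ^ c :=
  (Nat.mul_le_mul_right _ (Nat.pow_le_pow_left (Nat.le_succ n) a)).trans
    (by rw [← pow_add]; exact Nat.pow_le_pow_right n.succ_pos h)

/-- Arithmetic: the raw rank-test cost is `≤ 8 (n+1)⁷`. [folklore] -/
theorem rankTest_cost_arith :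
    n * (n * ((n + 1) * ((n + 1) * (n * n + n + 1) + (n + 1) + 1) + (n + 1)) + n) + n ≤
      8 * (n + 1) ^ 7 := by
  nlinarith [Nat.zero_le n, pow_mul_pow_le n (a := 6) (b := 0) (c := 7) (by norm_num),
    pow_mul_pow_le n (a := 2) (b := 4) (c := 7) (by norm_num)]

end Arith

section Degree

variable (n : ℕ)

/-- `deg D_w ≤ n` (each term is `± ∏_{a < n} X_{a, σ a}` or `0`). [folklore] -/
theorem totalDegree_bruhatDet_le (w : Fin n → Fin n) : (bruhatDet k n w).totalDegree ≤ n := by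
  unfold bruhatDet
  refine totalDegree_sum_le_of_le _ _ _ fun σ _ => ?_
  have hp : (∏ a : Fin n, (X (a, σ a) : MvPolynomial (Fin n × Fin n) k)).totalDegree ≤ n :=
    (totalDegree_prod_le_of_le _ _ 1 fun _ _ => totalDegree_X_le_one _).trans (by simp)
  split_ifs
  · rcases Int.units_eq_one_or (Equiv.Perm.sign σ) with h | h
    · rwa [h, one_smul]
    · rwa [h, Units.neg_smul, one_smul, totalDegree_neg]
  · rw [totalDegree_zero]
    exact Nat.zero_le _

end Degree

end BruhatDetVNP

end Summit.ValiantsHypothesis.ValiantsHypothesis.Theorems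

end
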